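import Mathlib
import Summits.Ventures.HodgeRepro.Tier4.Line4.DefiniteCompactRow
import Summits.Ventures.HodgeRepro.Tier4.Line4.SliceBallGrowth

/-!
# Tier4/Line4/ArchBallMixed — display (8)'s archimedean print `ArchBallGrowth` as ONE theorem on the line's plane:
the mixed row plane with the transported torus, from the sign data alone

Blind re-derivation cell `pub-hodge-repro`, Tier 4 «prove the step» (README §9–§10), seat t4-L4-p2 (prover, LINE L4,
gen 5; the assembly of C2 / stage C with L1-p2's ArchBallProduct and DefiniteCompactRow, for v0.42's (8)).  Tree path
`lean/Summits/Ventures/HodgeRepro/Tier4/Line4/ArchBallMixed.lean`.  Mathlib-level; no literature.  Imports L1-p2's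
`Line4/DefiniteCompactRow` (`hcpt_mixedRow_of_hdef`: the slices at the definite places `w ≠ w₀` are compact) and this
seat's `Line4/SliceBallGrowth` (`sliceBallGrowth_mixedRow_withTransportedTorus`: the slice at the indefinite place `w₀`
has `SliceBallGrowth`; through it L1-p2's `ArchBallProduct`: `archBallGrowth_of_slice`, `locallyCompact_atPlace`).

THE STATEMENT.  `W′ := (mixedRow q a b).withTransportedTorus g g′ hgg′ hg′g hgΩ` (the line's plane, `ε = −1`).  If
`w₀` is a real CM place at which the plane is indefinite (`a_{w₀} > 0`, `(−b)_{w₀} < 0`, i.e. `a_{w₀}, b_{w₀} > 0`) and at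
every other infinite place `w′` the plane is real, CM and DEFINITE (`hdef`: `a_{w′} · (−b)_{w′} > 0`), then EVERY Haar
measure `μ∞` of `G_∞ = infinitePart W′` has the archimedean ball growth `ArchBallGrowth W′ μ∞` — the ONE print of
display (8) (ArchBallReduce's `volumeGrowth_of_archBallGrowth′` then gives `VolumeGrowth`).  The Haar measures of the
slices are CHOSEN inside the proof (Mathlib's `Measure.haar` on the locally compact slices); no binder is left.

Nothing here says anything about the status of the Hodge conjecture for CM abelian varieties, which is NOT proved
(HC_CM is NOT proved by anyone in this repository).
-/

set_option autoImplicit false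

noncomputable section

namespace Summit.Ventures.HodgeRepro.Tier4.Line4

open Summit.Ventures.HodgeRepro.Tier4.Common Summit.Ventures.HodgeRepro.Tier4.Line1 MeasureTheory NumberField

section Mixed

variable {k : Type} [Field k] [NumberField k] (q : QuadData k) (a b : k)

/-- **Display (8)'s archimedean print on the line's plane, from the sign data**: `ArchBallGrowth W′ μ∞` for every Haar
`μ∞` on `G_∞`, where `W′ = (mixedRow q a b).withTransportedTorus …`, `w₀` real CM with `a_{w₀} > 0 > (−b)_{w₀}`, and
every `w′ ≠ w₀` real CM with `a_{w′} · (−b)_{w′} > 0` (definite). -/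
theorem archBallGrowth_mixedRow_withTransportedTorus (g g' : Matrix (Fin 4) (Fin 4) k) (hgg' : g * g' = 1)
    (hg'g : g' * g = 1) (hgΩ : g * (PlaneData.mixedRow q a b).Ω = (PlaneData.mixedRow q a b).Ω * g)
    {w₀ : InfinitePlace k} (hw : w₀.IsReal) (hcm : IsCMAt q w₀) (hq : 4 * q.n - q.t ^ 2 ≠ 0)
    (hα : 0 < alphaLoc a hw) (hβ : betaLoc b (-1) hw < 0)
    (hdef : ∀ w' : InfinitePlace k, w' ≠ w₀ → w'.IsReal ∧ IsCMAt q w' ∧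
      0 < (adToC w' (algebraMap k (Ad k) a)).re * (adToC w' (algebraMap k (Ad k) (-1 * b))).re)
    [MeasurableSpace (GA ((PlaneData.mixedRow q a b).withTransportedTorus g g' hgg' hg'g hgΩ))]
    [BorelSpace (GA ((PlaneData.mixedRow q a b).withTransportedTorus g g' hgg' hg'g hgΩ))]
    (μinf : Measure (infinitePart ((PlaneData.mixedRow q a b).withTransportedTorus g g' hgg' hg'g hgΩ)))
    [μinf.IsHaarMeasure] :
    ArchBallGrowth ((PlaneData.mixedRow q a b).withTransportedTorus g g' hgg' hg'g hgΩ) μinf := by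
  haveI : ∀ w : InfinitePlace k,
      LocallyCompactSpace (atPlace ((PlaneData.mixedRow q a b).withTransportedTorus g g' hgg' hg'g hgΩ) w) :=
    fun w => locallyCompact_atPlace _ w
  -- a Haar measure on every slice (Mathlib's `Measure.haar`)
  let ν : ∀ w : InfinitePlace k,
      Measure (atPlace ((PlaneData.mixedRow q a b).withTransportedTorus g g' hgg' hg'g hgΩ) w) :=
    fun _ => Measure.haar
  haveI : ∀ w, (ν w).IsHaarMeasure := fun _ => Measure.isHaarMeasure_haarMeasure _
  exact archBallGrowth_of_slice _ w₀ (hcpt_mixedRow_of_hdef q a b g g' hgg' hg'g hgΩ w₀ hdef) μinf ν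
    (sliceBallGrowth_mixedRow_withTransportedTorus q a b g g' hgg' hg'g hgΩ hw hcm hq hα hβ (ν w₀))

end Mixed

end Summit.Ventures.HodgeRepro.Tier4.Line4

end
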